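import Summits.HodgeConjecture.HodgeConjecture.Theorems.Q8SymplecticPowersTranscendentalOrthogonal
import Literature.AlgebraicGeometry.Motives.HodgeTensorHodgeGroupPolarizationProofs
import Literature.AlgebraicGeometry.Motives.HodgeStructureDirectSum
import Literature.AlgebraicGeometry.Motives.HodgeStructureQuotient
import HarnessLib

/-!
# Route `Q8SymplecticPowers`, programme K2Q — brick E-Q part 1: the `Hdg¹ ⊕ T` BLOCK EXTENSION `id ⊕ g`, its membership
# in the route's `Uni`, and «`End_HS(T)` commutes with the commutators of the quaternionic-unitary centraliser of `T`»

Support file for crux K2Q `PowersHodgeOfQuaternionCommutators` (stmt-HodgeConjecture-24191; `--supports … --as helper`;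
nothing here closes an item).  Prover seat `hodge-nonav-20241-p1` (g20).

Setting: `X` a smooth projective surface, `V = H²(X; ℚ)` with Hodge structure `H`, `N = Hdg¹(H)`, `T = N^{⊥ψ}` (`V = N ⊕ T`,
`Polarization.isCompl_hodgeClasses_orthogonal`).  The route's `Uni X hX τ j g` says: `g ∈ GL(V)` commutes with `τ^*, j^*`,
preserves `tr(x ∪ y)` and fixes `N` pointwise; `Comm` says commutators of such `g, h` lie in `Hg(H)`.

* §1 `blockExtend h g = id_N ⊕ g` for `g ∈ GL(T)` along a complementary pair (abstract), with `blockExtend_apply_add`,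
  multiplicativity `blockExtend_mul`, `blockExtend_one`, `blockExtend_inv`, `blockExtend_commutator`.
* §2 **`blockExtend_uni`**: if `g ∈ GL(T)` commutes with `τ^*|_T`, `j^*|_T` and preserves `tr(· ∪ ·)|_T`, then `id_N ⊕ g`
  satisfies the four `Uni` clauses (uses brick C-Q4: `N ⊥_{tr∘cup} T`).
* §3 **`hom_apply_commutator_eq`**: under `Comm`, every endomorphism of Hodge structures `φ` of `T` commutes with
  `g h g⁻¹ h⁻¹` for all such `g, h ∈ GL(T)` — the Hodge group commutes with `End_HS(H)`
  (`HodgeStructure.apply_apply_of_mem_hodgeGroup`) and `φ` extends to `End_HS(H)` through the Hodge-vector projector.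

This is the Hodge-theoretic input of the END-BOUND `dim_ℚ End_HS(T) ≤ 4` (memo PROGRAMME-K2Q §S1); the remaining steps are
linear algebra (Cayley ascent ASC-Q, ENGINE-CAYLEY).  HONEST FRAMING: bookkeeping only (axioms standard); item 24191 OPEN;
nothing here says HC ∕ HC_CM ∕ HC_AV is proved.

## References

* C. Voisin, *Hodge Theory and Complex Algebraic Geometry I* (2002), §7.1.2 Lemma 7.26, §7.3.1 Def. 7.22, §11.3.3.
  [cite: VoisinHodgeI2002]
* D. Huybrechts, *Lectures on K3 surfaces* (2016), Ch. 3 Cor. 3.4 and Thm. 3.3.9 (proof). [cite: Huybrechts2016K3]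
-/

set_option linter.dupNamespace false

noncomputable section

open scoped TensorProduct
open CategoryTheory
open Literature.AlgebraicGeometry.Motives Literature.AlgebraicGeometry.HodgeTheory
open Literature.AlgebraicGeometry.HodgeTheory.BettiUniverse
open Literature.AlgebraicGeometry.Motives.HodgeStructure
open Summit.HodgeConjecture.HodgeConjecture.Theorems.Q8SymplecticPowersTranscendentalPart
open Summit.HodgeConjecture.HodgeConjecture.Theorems.Q8SymplecticPowersTranscendentalOrthogonal

namespace Summit.HodgeConjecture.HodgeConjecture.Theorems.Q8SymplecticPowersBlockExtension

/-! ### §1 The block extension `id_N ⊕ g` along a complementary pair -/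

section Block

variable {V : Type*} [AddCommGroup V] [Module ℚ V] {N T : Submodule ℚ V}

/-- **`id_N ⊕ g`**: the automorphism of `V = N ⊕ T` that is the identity on `N` and `g` on `T`.
[cite: Huybrechts2016K3, Ch. 3 Cor. 3.4 (proof)] -/
def blockExtend (h : IsCompl N T) (g : T ≃ₗ[ℚ] T) : V ≃ₗ[ℚ] V :=
  (Submodule.prodEquivOfIsCompl N T h).symm ≪≫ₗ (LinearEquiv.refl ℚ N).prodCongr g ≪≫ₗ Submodule.prodEquivOfIsCompl N T h

/-- `(id_N ⊕ g)(n + t) = n + g t`. [folklore] -/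
theorem blockExtend_apply_add (h : IsCompl N T) (g : T ≃ₗ[ℚ] T) (n : N) (t : T) :
    blockExtend h g ((n : V) + t) = (n : V) + (g t : V) := by
  have hs : (Submodule.prodEquivOfIsCompl N T h).symm ((n : V) + t) = (n, t) :=
    (Submodule.prodEquivOfIsCompl N T h).symm_apply_eq.2 (by simp)
  simp [blockExtend, LinearEquiv.trans_apply, hs]

/-- `(id_N ⊕ g) n = n` on `N`. [folklore] -/
theorem blockExtend_apply_left (h : IsCompl N T) (g : T ≃ₗ[ℚ] T) (n : N) : blockExtend h g (n : V) = n := by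
  simpa using blockExtend_apply_add h g n 0

/-- `(id_N ⊕ g) t = g t` on `T`. [folklore] -/
theorem blockExtend_apply_right (h : IsCompl N T) (g : T ≃ₗ[ℚ] T) (t : T) : blockExtend h g (t : V) = g t := by
  simpa using blockExtend_apply_add h g 0 t

/-- Every `x ∈ V` is `n + t`. [folklore] -/
theorem exists_eq_add (h : IsCompl N T) (x : V) : ∃ (n : N) (t : T), x = (n : V) + t :=
  ⟨((Submodule.prodEquivOfIsCompl N T h).symm x).1, ((Submodule.prodEquivOfIsCompl N T h).symm x).2,
    ((Submodule.prodEquivOfIsCompl N T h).apply_symm_apply x).symm⟩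

/-- `id_N ⊕ (g g') = (id_N ⊕ g)(id_N ⊕ g')`. [folklore] -/
theorem blockExtend_mul (h : IsCompl N T) (g g' : T ≃ₗ[ℚ] T) : blockExtend h (g * g') = blockExtend h g * blockExtend h g' := by
  refine LinearEquiv.ext fun x => ?_
  obtain ⟨n, t, rfl⟩ := exists_eq_add h x
  rw [LinearEquiv.mul_apply, blockExtend_apply_add, blockExtend_apply_add, blockExtend_apply_add, LinearEquiv.mul_apply]

/-- `id_N ⊕ id_T = id`. [folklore] -/
theorem blockExtend_one (h : IsCompl N T) : blockExtend h (1 : T ≃ₗ[ℚ] T) = 1 := by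
  refine LinearEquiv.ext fun x => ?_
  obtain ⟨n, t, rfl⟩ := exists_eq_add h x
  rw [blockExtend_apply_add]
  rfl

/-- `id_N ⊕ g⁻¹ = (id_N ⊕ g)⁻¹`. [folklore] -/
theorem blockExtend_inv (h : IsCompl N T) (g : T ≃ₗ[ℚ] T) : blockExtend h g⁻¹ = (blockExtend h g)⁻¹ :=
  eq_inv_of_mul_eq_one_left (by rw [← blockExtend_mul, inv_mul_cancel, blockExtend_one h])

/-- `id_N ⊕ [g, g'] = [id_N ⊕ g, id_N ⊕ g']`. [folklore] -/
theorem blockExtend_commutator (h : IsCompl N T) (g g' : T ≃ₗ[ℚ] T) :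
    blockExtend h (g * g' * g⁻¹ * g'⁻¹) =
      blockExtend h g * blockExtend h g' * (blockExtend h g)⁻¹ * (blockExtend h g')⁻¹ := by
  rw [blockExtend_mul, blockExtend_mul, blockExtend_mul, blockExtend_inv, blockExtend_inv]

end Block

/-! ### §2 `id_N ⊕ g ∈ Uni` for `g` in the quaternionic-unitary centraliser of `T` -/

variable {X : SchemeOver ℂ}

/-- `σ^*` preserves the Hodge classes `Hdg¹(H²X)` (it is a morphism of Hodge structures). [cite: VoisinHodgeI2002, §7.3.2] -/
theorem pull_mem_hodgeClasses (hX : IsSmoothProjective 2 X) (σ : X ⟶ X) {n : bettiCohomology X 2}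
    (hn : n ∈ (hodge exists_isReal_hodgeModel_holds hX 2).hodgeClasses 1) :
    pull σ 2 n ∈ (hodge exists_isReal_hodgeModel_holds hX 2).hodgeClasses 1 :=
  Hom.map_hodgeClasses_le (pullHodgeHom exists_isReal_hodgeModel_holds hodgePQ_independent_of_hodgeModel_holds hX hX σ 2) 1
    ⟨n, hn, rfl⟩

/-- **`id_N ⊕ g ∈ Uni`**: for `T = Hdg¹(H²X)^{⊥ψ}` (given as a submodule `T` with `T = Hdg¹^{⊥ψ}`) and `g ∈ GL(T)` commuting with
`τ^*|_T`, `j^*|_T` and preserving `tr(· ∪ ·)` on `T`, the block extension `G = id_N ⊕ g` commutes with `τ^*`, `j^*`, preserves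
`tr(x ∪ y)` on all of `H²(X; ℚ)` (C-Q4: `N ⊥_{tr∘cup} T`) and fixes `Hdg¹` pointwise — the four clauses of the route's `Uni`.
[cite: Huybrechts2016K3, Ch. 3 Cor. 3.4 (proof) and Lemma 3.1] [cite: VoisinHodgeI2002, §7.1.2 Lemma 7.26] -/
theorem blockExtend_uni (hX : IsSmoothProjective 2 X) (ψ : Polarization (hodge exists_isReal_hodgeModel_holds hX 2))
    {T : Submodule ℚ (bettiCohomology X 2)}
    (hT : T = ψ.form.orthogonal ((hodge exists_isReal_hodgeModel_holds hX 2).hodgeClasses 1))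
    (h : IsCompl ((hodge exists_isReal_hodgeModel_holds hX 2).hodgeClasses 1) T) (τ j : X ⟶ X) (g : T ≃ₗ[ℚ] T)
    (hgτ : ∀ x : T, (g ⟨pull τ 2 x, hT.ge (pull_mem_transcendental hX ψ τ (hT.le x.2))⟩ : bettiCohomology X 2) =
      pull τ 2 (g x : bettiCohomology X 2))
    (hgj : ∀ x : T, (g ⟨pull j 2 x, hT.ge (pull_mem_transcendental hX ψ j (hT.le x.2))⟩ : bettiCohomology X 2) =
      pull j 2 (g x : bettiCohomology X 2))
    (hgQ : ∀ x y : T, tr hX (2 + 2) (cup X 2 2 (g x : bettiCohomology X 2) (g y)) =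
      tr hX (2 + 2) (cup X 2 2 (x : bettiCohomology X 2) y)) :
    (∀ x, blockExtend h g (pull τ 2 x) = pull τ 2 (blockExtend h g x)) ∧
      (∀ x, blockExtend h g (pull j 2 x) = pull j 2 (blockExtend h g x)) ∧
      (∀ x y, tr hX (2 + 2) (cup X 2 2 (blockExtend h g x) (blockExtend h g y)) = tr hX (2 + 2) (cup X 2 2 x y)) ∧
      ∀ x ∈ (hodge exists_isReal_hodgeModel_holds hX 2).hodgeClasses 1, blockExtend h g x = x := by
  have hmemT : ∀ t : T, (t : bettiCohomology X 2) ∈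
      ψ.form.orthogonal ((hodge exists_isReal_hodgeModel_holds hX 2).hodgeClasses 1) := fun t => hT.le t.2
  have hdeck : ∀ σ : X ⟶ X, (∀ x : T, (g ⟨pull σ 2 x, hT.ge (pull_mem_transcendental hX ψ σ (hT.le x.2))⟩ :
      bettiCohomology X 2) = pull σ 2 (g x : bettiCohomology X 2)) →
      ∀ x, blockExtend h g (pull σ 2 x) = pull σ 2 (blockExtend h g x) := by
    intro σ hσ x
    obtain ⟨n, t, rfl⟩ := exists_eq_add h x
    have hn' : pull σ 2 n ∈ (hodge exists_isReal_hodgeModel_holds hX 2).hodgeClasses 1 := pull_mem_hodgeClasses hX σ n.2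
    have ht' : pull σ 2 t ∈ T := hT.ge (pull_mem_transcendental hX ψ σ (hmemT t))
    rw [blockExtend_apply_add, map_add (pull σ 2), map_add (pull σ 2),
      show pull σ 2 (n : bettiCohomology X 2) + pull σ 2 (t : bettiCohomology X 2) =
        ((⟨pull σ 2 n, hn'⟩ : (hodge exists_isReal_hodgeModel_holds hX 2).hodgeClasses 1) : bettiCohomology X 2) +
          ((⟨pull σ 2 t, ht'⟩ : T) : bettiCohomology X 2) from rfl,
      blockExtend_apply_add, hσ t]
  refine ⟨hdeck τ hgτ, hdeck j hgj, fun x y => ?_, fun x hx => ?_⟩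
  · obtain ⟨n, t, rfl⟩ := exists_eq_add h x
    obtain ⟨n', t', rfl⟩ := exists_eq_add h y
    rw [blockExtend_apply_add, blockExtend_apply_add,
      tr_cup_add_add hX ψ n.2 n'.2 (hmemT (g t)) (hmemT (g t')), tr_cup_add_add hX ψ n.2 n'.2 (hmemT t) (hmemT t'), hgQ]
  · exact blockExtend_apply_left h g ⟨x, hx⟩

/-! ### §3 `End_HS(T)` commutes with the commutators of the quaternionic-unitary centraliser of `T` -/

/-- **Under `Comm`, every `φ ∈ End_HS(T)` commutes with `g h g⁻¹ h⁻¹` for all `g, h ∈ GL(T)` commuting with `τ^*|_T`, `j^*|_T`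
and preserving `tr(· ∪ ·)|_T`.**  The commutator `K = [id_N ⊕ g, id_N ⊕ h]` lies in `Hg(H²X)` (`Comm` + `blockExtend_uni`),
`K|_T = [g, h]` (`blockExtend_commutator`), and `Φ = ι_T ∘ φ ∘ (1 - P)` (`P` the Hodge-vector projector onto `N` along `T`)
is an endomorphism of Hodge structures of `H²(X)`, which commutes with `Hg` (`HodgeStructure.apply_apply_of_mem_hodgeGroup`).
[cite: Huybrechts2016K3, Thm. 3.3.9 (proof, p. 67)] [cite: VoisinHodgeI2002, §7.3.1 Def. 7.22 and Lemma 7.26] -/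
theorem hom_apply_commutator_eq (hX : IsSmoothProjective 2 X) (ψ : Polarization (hodge exists_isReal_hodgeModel_holds hX 2))
    (τ j : X ⟶ X)
    (hComm : haveI := finite hX 2; haveI : HodgeTensorFacts.{0, 0} := hodgeTensorFacts_holds;
      ∀ g h : bettiCohomology X 2 ≃ₗ[ℚ] bettiCohomology X 2,
        ((∀ x, g (pull τ 2 x) = pull τ 2 (g x)) ∧ (∀ x, g (pull j 2 x) = pull j 2 (g x)) ∧
          (∀ x y, tr hX (2 + 2) (cup X 2 2 (g x) (g y)) = tr hX (2 + 2) (cup X 2 2 x y)) ∧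
          ∀ x ∈ (hodge exists_isReal_hodgeModel_holds hX 2).hodgeClasses 1, g x = x) →
        ((∀ x, h (pull τ 2 x) = pull τ 2 (h x)) ∧ (∀ x, h (pull j 2 x) = pull j 2 (h x)) ∧
          (∀ x y, tr hX (2 + 2) (cup X 2 2 (h x) (h y)) = tr hX (2 + 2) (cup X 2 2 x y)) ∧
          ∀ x ∈ (hodge exists_isReal_hodgeModel_holds hX 2).hodgeClasses 1, h x = x) →
        g * h * g⁻¹ * h⁻¹ ∈ (hodge exists_isReal_hodgeModel_holds hX 2).hodgeGroup)
    {T : SubHodgeStructure (hodge exists_isReal_hodgeModel_holds hX 2)}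
    (hT : T.toSubmodule = ψ.form.orthogonal ((hodge exists_isReal_hodgeModel_holds hX 2).hodgeClasses 1))
    (φ : Hom T.toHodgeStructure T.toHodgeStructure) (g h : T.toSubmodule ≃ₗ[ℚ] T.toSubmodule)
    (hgτ : ∀ x : T.toSubmodule, (g ⟨pull τ 2 x, hT.ge (pull_mem_transcendental hX ψ τ (hT.le x.2))⟩ : bettiCohomology X 2) =
      pull τ 2 (g x : bettiCohomology X 2))
    (hgj : ∀ x : T.toSubmodule, (g ⟨pull j 2 x, hT.ge (pull_mem_transcendental hX ψ j (hT.le x.2))⟩ : bettiCohomology X 2) =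
      pull j 2 (g x : bettiCohomology X 2))
    (hgQ : ∀ x y : T.toSubmodule, tr hX (2 + 2) (cup X 2 2 (g x : bettiCohomology X 2) (g y)) =
      tr hX (2 + 2) (cup X 2 2 (x : bettiCohomology X 2) y))
    (hhτ : ∀ x : T.toSubmodule, (h ⟨pull τ 2 x, hT.ge (pull_mem_transcendental hX ψ τ (hT.le x.2))⟩ : bettiCohomology X 2) =
      pull τ 2 (h x : bettiCohomology X 2))
    (hhj : ∀ x : T.toSubmodule, (h ⟨pull j 2 x, hT.ge (pull_mem_transcendental hX ψ j (hT.le x.2))⟩ : bettiCohomology X 2) =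
      pull j 2 (h x : bettiCohomology X 2))
    (hhQ : ∀ x y : T.toSubmodule, tr hX (2 + 2) (cup X 2 2 (h x : bettiCohomology X 2) (h y)) =
      tr hX (2 + 2) (cup X 2 2 (x : bettiCohomology X 2) y))
    (x : T.toSubmodule) :
    φ.toLinearMap ((g * h * g⁻¹ * h⁻¹) x) = (g * h * g⁻¹ * h⁻¹) (φ.toLinearMap x) := by
  haveI := finite hX 2
  haveI : HodgeTensorFacts.{0, 0} := hodgeTensorFacts_holds
  have h11 : (1 : ℤ) + 1 = ((2 : ℕ) : ℤ) := by norm_num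
  have hc : IsCompl ((hodge exists_isReal_hodgeModel_holds hX 2).hodgeClasses 1) T.toSubmodule := by
    rw [hT]; exact ψ.isCompl_hodgeClasses_orthogonal h11
  -- the commutator of the block extensions lies in the Hodge group
  have hK : blockExtend hc (g * h * g⁻¹ * h⁻¹) ∈ (hodge exists_isReal_hodgeModel_holds hX 2).hodgeGroup := by
    rw [blockExtend_commutator]
    exact hComm _ _ (blockExtend_uni hX ψ hT hc τ j g hgτ hgj hgQ) (blockExtend_uni hX ψ hT hc τ j h hhτ hhj hhQ)
  -- `Φ = ι_T ∘ φ ∘ (projection onto T along N)` is an endomorphism of Hodge structures of `H²(X)`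
  obtain ⟨P, hPmem, hP₁, hP₀⟩ := ψ.exists_hodgeVectorProjector h11
  have hQmem : (1 - P : Module.End ℚ (bettiCohomology X 2)) ∈ (hodge exists_isReal_hodgeModel_holds hX 2).endAlg :=
    Subalgebra.sub_mem _ (Subalgebra.one_mem _) hPmem
  have hQT : ∀ v, (1 - P) v ∈ T.toSubmodule := fun v => by
    obtain ⟨n, t, rfl⟩ := exists_eq_add hc v
    rw [LinearMap.sub_apply, Module.End.one_apply, map_add, hP₁ _ n.2, hP₀ _ (hT.le t.2), add_zero, add_sub_cancel_left]
    exact t.2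
  let π : Hom (hodge exists_isReal_hodgeModel_holds hX 2) T.toHodgeStructure :=
    Hom.codRestrict (endAlg.toHom ⟨1 - P, hQmem⟩) T hQT
  let Φ : Hom (hodge exists_isReal_hodgeModel_holds hX 2) (hodge exists_isReal_hodgeModel_holds hX 2) :=
    T.subtypeHom.comp (φ.comp π)
  have hΦ : ∀ t : T.toSubmodule, Φ.toLinearMap (t : bettiCohomology X 2) = (φ.toLinearMap t : bettiCohomology X 2) := by
    intro t
    have hπ : π.toLinearMap (t : bettiCohomology X 2) = t := by
      apply Subtype.ext
      change (1 - P) (t : bettiCohomology X 2) = t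
      rw [LinearMap.sub_apply, Module.End.one_apply, hP₀ _ (hT.le t.2), sub_zero]
    change (T.toSubmodule.subtype (φ.toLinearMap (π.toLinearMap t))) = _
    rw [hπ, Submodule.subtype_apply]
  -- the Hodge group commutes with `Φ`
  have hcomm := HodgeStructure.apply_apply_of_mem_hodgeGroup (hodge exists_isReal_hodgeModel_holds hX 2) hK
    ⟨Φ.toLinearMap, Φ.toLinearMap_mem_endAlg⟩ (x : bettiCohomology X 2)
  change Φ.toLinearMap (blockExtend hc (g * h * g⁻¹ * h⁻¹) (x : bettiCohomology X 2)) =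
    blockExtend hc (g * h * g⁻¹ * h⁻¹) (Φ.toLinearMap (x : bettiCohomology X 2)) at hcomm
  rw [blockExtend_apply_right, hΦ, hΦ, blockExtend_apply_right] at hcomm
  exact Subtype.ext hcomm

end Summit.HodgeConjecture.HodgeConjecture.Theorems.Q8SymplecticPowersBlockExtension

end
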